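import Summits.AtomisticToContinuum.Crystallization.Theorems.OverbindingBudgetAffineRunCutAxialTaylor
import Summits.AtomisticToContinuum.Crystallization.Theorems.OverbindingBudgetAffineRunCutAxialLaneB
import Summits.AtomisticToContinuum.Crystallization.Theorems.OverbindingBudgetAffineTwinGainCertificate

/-!
# `OverbindingBudget` / crux `RobustDefectLimitWindows` (stmt-AtomisticToContinuum-31280) — «RunCut»: the axial window, generic enclosures and `k = 2`

Support file (lens-4 g86, hand-in 3 part 0 for the competitor leaf **SW♭** `StackSwapGainFlat(Wide)`; memo `g86/memo/SW-G1.md` §7).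
The AXIAL WINDOW of the competitor's affine charts is `|t − 2/3| ≤ 1/340`, `t = (h/a)²` (relative spacing deviation `≤ 2.2·10⁻³ ≥ 2θ₀`).  For the
layer `k` the registry argument is `s = k²t = s_k + Δ`, `s_k = 2k²/3`, `|Δ| ≤ k²/340` (so `8|Δ| ≤ s_k`).  From the third-order expansions of
`…RunCutAxialTaylor` this file derives

* §1 helpers (crude pair bounds `L⁰_n + L¹_n ≤ 2s⁻ⁿ + 104/(3(n−1))·s⁻⁽ⁿ⁻¹⁾` from `layerSum_le_of_pos`, `|J⁽ⁿ⁾| ≤ L⁰_n + L¹_n`);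
* §2 the GENERIC window enclosures: `|J⁽³⁾(s₀+Δ)| ≤ β₀ + 3Dβ₁ + 6D²β₂ + 18D³(2s₀⁻⁶ + 104/15·s₀⁻⁵)` from `|J⁽³⁾(s₀)| ≤ β₀`, `|J⁽⁴⁾(s₀)| ≤ β₁`,
  `|J⁽⁵⁾(s₀)| ≤ β₂`, `|Δ| ≤ D`, `8D ≤ s₀` — and the `J⁽⁶⁾` analogue (`6, 21, 200`, `2s₀⁻⁹ + 13/3·s₀⁻⁸`), plus the SIGNED versions for the driving layer;
* §3 the driving layer `k = 2` over the window: `0.0004712 ≤ J⁽³⁾(4t)` and `J⁽⁶⁾(4t) ≤ 0.0002161` (ideal values `0.00048855`, `0.00020683`; inputs: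
  `registryCoupling_three_at_2` / `_six_at_2` of the kit, `J⁽⁴⁾, J⁽⁷⁾(8/3)` of `…RunCutAxial`, `J⁽⁵⁾ ≥ 0`, `J⁽⁸⁾(8/3)` of `…RunCutAxialLaneB`), hence
  `J₂(a, a√t) ≤ (1/12)a⁻¹²·0.0002161 − (1/6)a⁻⁶·0.0004712`;
* §4 the far layers over the window: `|J⁽³⁾(k²t)| ≤ 126·k⁻⁶`, `|J⁽⁶⁾(k²t)| ≤ k⁻⁶/5000` for `k ≥ 22` (`k²t ≥ 484·677/1020 ≥ 320`).

The nineteen layers `3 ≤ k ≤ 21` are `…RunCutAxialWindowThree/Six`, the column certificate `…RunCutAxialWindowGain`.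
[this file: 0 definitions, 18 theorems; standard axioms]
-/

noncomputable section

namespace Summit.AtomisticToContinuum.Crystallization.Theorems.OverbindingBudgetAffineRunCutAxialWindow

open Literature.MathematicalPhysics.StatisticalMechanics
open Literature.MathematicalPhysics.StatisticalMechanics.StackingSums
open Summit.AtomisticToContinuum.Crystallization.Theorems.OverbindingBudgetAffineRunCutAxialTaylor
open Summit.AtomisticToContinuum.Crystallization.Theorems.OverbindingBudgetAffineRunCutAxial
  (registryCoupling_four_mem registryCoupling_seven_mem)
open Summit.AtomisticToContinuum.Crystallization.Theorems.OverbindingBudgetAffineRunCutAxialLaneB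
  (registryCoupling_5_mem_2 registryCoupling_8_mem_2)
open Summit.AtomisticToContinuum.Crystallization.Theorems.OverbindingBudgetAffineTwinGainEnclosures
  (registryCoupling_six_abs_crude)

/-! ## §1 Helpers -/

/-- `|x| ≤ β` from an enclosure `lo ≤ x ≤ hi` with `−β ≤ lo`, `hi ≤ β`. [folklore] -/
theorem abs_le_of_mem {x lo hi β : ℝ} (h : lo ≤ x ∧ x ≤ hi) (h1 : -β ≤ lo) (h2 : hi ≤ β) : |x| ≤ β :=
  abs_le.2 ⟨by linarith [h.1], by linarith [h.2]⟩

/-- The axial window lies in `t ≥ 0`. [folklore] -/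
theorem window_nonneg {t : ℝ} (ht : |t - 2 / 3| ≤ 1 / 340) : 0 ≤ t := by
  have := neg_abs_le (t - 2 / 3)
  linarith

/-- `|J⁽ⁿ⁾(s)| ≤ L⁰_n(s) + L¹_n(s)` (`0 ≤ s`). [this file · kind: proof] -/
theorem abs_registryCoupling_le_pair (n : ℕ) {s : ℝ} (hs : 0 ≤ s) :
    |registryCoupling n s| ≤ layerSum 0 n s + layerSum 1 n s := by
  have n0 := layerSum_nonneg (δ := 0) (by norm_num) n hs
  have n1 := layerSum_nonneg (δ := 1) le_rfl n hs
  unfold registryCoupling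
  rw [abs_le]; constructor <;> linarith

/-- `L⁰₅ + L¹₅ ≤ 2s⁻⁵ + 26/3·s⁻⁴` (`0 < s`). [this file · kind: proof] -/
theorem pair_five_le {s : ℝ} (hs : 0 < s) : layerSum 0 5 s + layerSum 1 5 s ≤ 2 * (s⁻¹) ^ 5 + 26 / 3 * (s⁻¹) ^ 4 := by
  have h0 := layerSum_le_of_pos (δ := 0) (by norm_num) hs (d := 4) (by norm_num)
  have h1 := layerSum_le_of_pos (δ := 1) le_rfl hs (d := 4) (by norm_num)
  norm_num at h0 h1 ⊢
  linarith

/-- `L⁰₆ + L¹₆ ≤ 2s⁻⁶ + 104/15·s⁻⁵`. [this file · kind: proof] -/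
theorem pair_six_le {s : ℝ} (hs : 0 < s) : layerSum 0 6 s + layerSum 1 6 s ≤ 2 * (s⁻¹) ^ 6 + 104 / 15 * (s⁻¹) ^ 5 := by
  have h0 := layerSum_le_of_pos (δ := 0) (by norm_num) hs (d := 5) (by norm_num)
  have h1 := layerSum_le_of_pos (δ := 1) le_rfl hs (d := 5) (by norm_num)
  norm_num at h0 h1 ⊢
  linarith

/-- `L⁰₇ + L¹₇ ≤ 2s⁻⁷ + 52/9·s⁻⁶`. [this file · kind: proof] -/
theorem pair_seven_le {s : ℝ} (hs : 0 < s) : layerSum 0 7 s + layerSum 1 7 s ≤ 2 * (s⁻¹) ^ 7 + 52 / 9 * (s⁻¹) ^ 6 := by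
  have h0 := layerSum_le_of_pos (δ := 0) (by norm_num) hs (d := 6) (by norm_num)
  have h1 := layerSum_le_of_pos (δ := 1) le_rfl hs (d := 6) (by norm_num)
  norm_num at h0 h1 ⊢
  linarith

/-- `L⁰₈ + L¹₈ ≤ 2s⁻⁸ + 104/21·s⁻⁷`. [this file · kind: proof] -/
theorem pair_eight_le {s : ℝ} (hs : 0 < s) : layerSum 0 8 s + layerSum 1 8 s ≤ 2 * (s⁻¹) ^ 8 + 104 / 21 * (s⁻¹) ^ 7 := by
  have h0 := layerSum_le_of_pos (δ := 0) (by norm_num) hs (d := 7) (by norm_num)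
  have h1 := layerSum_le_of_pos (δ := 1) le_rfl hs (d := 7) (by norm_num)
  norm_num at h0 h1 ⊢
  linarith

/-- `L⁰₉ + L¹₉ ≤ 2s⁻⁹ + 13/3·s⁻⁸`. [this file · kind: proof] -/
theorem pair_nine_le {s : ℝ} (hs : 0 < s) : layerSum 0 9 s + layerSum 1 9 s ≤ 2 * (s⁻¹) ^ 9 + 13 / 3 * (s⁻¹) ^ 8 := by
  have h0 := layerSum_le_of_pos (δ := 0) (by norm_num) hs (d := 8) (by norm_num)
  have h1 := layerSum_le_of_pos (δ := 1) le_rfl hs (d := 8) (by norm_num)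
  norm_num at h0 h1 ⊢
  linarith

/-! ## §2 Generic window enclosures -/

/-- **`J⁽³⁾` over a window, absolute**: `|J⁽³⁾(s₀+Δ)| ≤ β₀ + 3Dβ₁ + 6D²β₂ + 18D³(2s₀⁻⁶ + 104/15·s₀⁻⁵)`. [this file · kind: proof] -/
theorem registryCoupling_three_window {s₀ Δ D β₀ β₁ β₂ : ℝ} (hs : 0 < s₀) (hD : 8 * D ≤ s₀) (hΔ : |Δ| ≤ D)
    (h0 : |registryCoupling 3 s₀| ≤ β₀) (h1 : |registryCoupling 4 s₀| ≤ β₁) (h2 : |registryCoupling 5 s₀| ≤ β₂) :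
    |registryCoupling 3 (s₀ + Δ)| ≤
      β₀ + 3 * D * β₁ + 6 * D ^ 2 * β₂ + 18 * D ^ 3 * (2 * (s₀⁻¹) ^ 6 + 104 / 15 * (s₀⁻¹) ^ 5) := by
  have hD0 : 0 ≤ D := (abs_nonneg Δ).trans hΔ
  have hT := registryCoupling_three_taylor (Δ := Δ) hs (by linarith [abs_nonneg Δ])
  have hb1 : 0 ≤ β₁ := (abs_nonneg _).trans h1
  have hb2 : 0 ≤ β₂ := (abs_nonneg _).trans h2
  have e1 : |3 * Δ * registryCoupling 4 s₀| ≤ 3 * D * β₁ := by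
    rw [abs_mul, abs_mul, abs_of_pos (by norm_num : (0:ℝ) < 3)]
    exact mul_le_mul (mul_le_mul_of_nonneg_left hΔ (by norm_num)) h1 (abs_nonneg _) (by positivity)
  have e2 : |6 * Δ ^ 2 * registryCoupling 5 s₀| ≤ 6 * D ^ 2 * β₂ := by
    rw [abs_mul, abs_mul, abs_of_pos (by norm_num : (0:ℝ) < 6), abs_pow]
    exact mul_le_mul (mul_le_mul_of_nonneg_left (pow_le_pow_left₀ (abs_nonneg Δ) hΔ 2) (by norm_num)) h2
      (abs_nonneg _) (by positivity)
  have e3 : 18 * |Δ| ^ 3 * (layerSum 0 6 s₀ + layerSum 1 6 s₀) ≤ 18 * D ^ 3 * (2 * (s₀⁻¹) ^ 6 + 104 / 15 * (s₀⁻¹) ^ 5) :=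
    mul_le_mul (mul_le_mul_of_nonneg_left (pow_le_pow_left₀ (abs_nonneg Δ) hΔ 3) (by norm_num)) (pair_six_le hs)
      (add_nonneg (layerSum_nonneg (by norm_num) 6 hs.le) (layerSum_nonneg le_rfl 6 hs.le)) (by positivity)
  rw [abs_le] at hT h0 e1 e2 ⊢
  constructor <;> linarith [hT.1, hT.2, h0.1, h0.2, e1.1, e1.2, e2.1, e2.2]

/-- **`J⁽³⁾` over a window, lower** (driving layer): `b₀ − 3Dβ₁ − 18D³(2s₀⁻⁶ + 104/15·s₀⁻⁵) ≤ J⁽³⁾(s₀+Δ)` from `b₀ ≤ J⁽³⁾(s₀)`,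
`|J⁽⁴⁾(s₀)| ≤ β₁`, `0 ≤ J⁽⁵⁾(s₀)` (the second-order term `6Δ²J⁽⁵⁾ ≥ 0` is dropped). [this file · kind: proof] -/
theorem registryCoupling_three_window_ge {s₀ Δ D b₀ β₁ : ℝ} (hs : 0 < s₀) (hD : 8 * D ≤ s₀) (hΔ : |Δ| ≤ D)
    (h0 : b₀ ≤ registryCoupling 3 s₀) (h1 : |registryCoupling 4 s₀| ≤ β₁) (h2 : 0 ≤ registryCoupling 5 s₀) :
    b₀ - 3 * D * β₁ - 18 * D ^ 3 * (2 * (s₀⁻¹) ^ 6 + 104 / 15 * (s₀⁻¹) ^ 5) ≤ registryCoupling 3 (s₀ + Δ) := by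
  have hD0 : 0 ≤ D := (abs_nonneg Δ).trans hΔ
  have hT := registryCoupling_three_taylor (Δ := Δ) hs (by linarith [abs_nonneg Δ])
  have hb1 : 0 ≤ β₁ := (abs_nonneg _).trans h1
  have e1 : |3 * Δ * registryCoupling 4 s₀| ≤ 3 * D * β₁ := by
    rw [abs_mul, abs_mul, abs_of_pos (by norm_num : (0:ℝ) < 3)]
    exact mul_le_mul (mul_le_mul_of_nonneg_left hΔ (by norm_num)) h1 (abs_nonneg _) (by positivity)
  have e2 : 0 ≤ 6 * Δ ^ 2 * registryCoupling 5 s₀ := mul_nonneg (by positivity) h2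
  have e3 : 18 * |Δ| ^ 3 * (layerSum 0 6 s₀ + layerSum 1 6 s₀) ≤ 18 * D ^ 3 * (2 * (s₀⁻¹) ^ 6 + 104 / 15 * (s₀⁻¹) ^ 5) :=
    mul_le_mul (mul_le_mul_of_nonneg_left (pow_le_pow_left₀ (abs_nonneg Δ) hΔ 3) (by norm_num)) (pair_six_le hs)
      (add_nonneg (layerSum_nonneg (by norm_num) 6 hs.le) (layerSum_nonneg le_rfl 6 hs.le)) (by positivity)
  rw [abs_le] at hT e1
  linarith [hT.1, hT.2, e1.1, e1.2]

/-- **`J⁽⁶⁾` over a window, absolute**: `|J⁽⁶⁾(s₀+Δ)| ≤ β₀ + 6Dβ₁ + 21D²β₂ + 200D³(2s₀⁻⁹ + 13/3·s₀⁻⁸)`. [this file · kind: proof] -/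
theorem registryCoupling_six_window {s₀ Δ D β₀ β₁ β₂ : ℝ} (hs : 0 < s₀) (hD : 8 * D ≤ s₀) (hΔ : |Δ| ≤ D)
    (h0 : |registryCoupling 6 s₀| ≤ β₀) (h1 : |registryCoupling 7 s₀| ≤ β₁) (h2 : |registryCoupling 8 s₀| ≤ β₂) :
    |registryCoupling 6 (s₀ + Δ)| ≤
      β₀ + 6 * D * β₁ + 21 * D ^ 2 * β₂ + 200 * D ^ 3 * (2 * (s₀⁻¹) ^ 9 + 13 / 3 * (s₀⁻¹) ^ 8) := by
  have hD0 : 0 ≤ D := (abs_nonneg Δ).trans hΔ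
  have hT := registryCoupling_six_taylor (Δ := Δ) hs (by linarith [abs_nonneg Δ])
  have hb1 : 0 ≤ β₁ := (abs_nonneg _).trans h1
  have hb2 : 0 ≤ β₂ := (abs_nonneg _).trans h2
  have e1 : |6 * Δ * registryCoupling 7 s₀| ≤ 6 * D * β₁ := by
    rw [abs_mul, abs_mul, abs_of_pos (by norm_num : (0:ℝ) < 6)]
    exact mul_le_mul (mul_le_mul_of_nonneg_left hΔ (by norm_num)) h1 (abs_nonneg _) (by positivity)
  have e2 : |21 * Δ ^ 2 * registryCoupling 8 s₀| ≤ 21 * D ^ 2 * β₂ := by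
    rw [abs_mul, abs_mul, abs_of_pos (by norm_num : (0:ℝ) < 21), abs_pow]
    exact mul_le_mul (mul_le_mul_of_nonneg_left (pow_le_pow_left₀ (abs_nonneg Δ) hΔ 2) (by norm_num)) h2
      (abs_nonneg _) (by positivity)
  have e3 : 200 * |Δ| ^ 3 * (layerSum 0 9 s₀ + layerSum 1 9 s₀) ≤ 200 * D ^ 3 * (2 * (s₀⁻¹) ^ 9 + 13 / 3 * (s₀⁻¹) ^ 8) :=
    mul_le_mul (mul_le_mul_of_nonneg_left (pow_le_pow_left₀ (abs_nonneg Δ) hΔ 3) (by norm_num)) (pair_nine_le hs)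
      (add_nonneg (layerSum_nonneg (by norm_num) 9 hs.le) (layerSum_nonneg le_rfl 9 hs.le)) (by positivity)
  rw [abs_le] at hT h0 e1 e2 ⊢
  constructor <;> linarith [hT.1, hT.2, h0.1, h0.2, e1.1, e1.2, e2.1, e2.2]

/-- **`J⁽⁶⁾` over a window, upper** (driving layer): `J⁽⁶⁾(s₀+Δ) ≤ B₀ + 6Dβ₁ + 21D²β₂ + 200D³(2s₀⁻⁹ + 13/3·s₀⁻⁸)`. [this file · kind: proof] -/
theorem registryCoupling_six_window_le {s₀ Δ D B₀ β₁ β₂ : ℝ} (hs : 0 < s₀) (hD : 8 * D ≤ s₀) (hΔ : |Δ| ≤ D)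
    (h0 : registryCoupling 6 s₀ ≤ B₀) (h1 : |registryCoupling 7 s₀| ≤ β₁) (h2 : |registryCoupling 8 s₀| ≤ β₂) :
    registryCoupling 6 (s₀ + Δ) ≤ B₀ + 6 * D * β₁ + 21 * D ^ 2 * β₂ + 200 * D ^ 3 * (2 * (s₀⁻¹) ^ 9 + 13 / 3 * (s₀⁻¹) ^ 8) := by
  have hD0 : 0 ≤ D := (abs_nonneg Δ).trans hΔ
  have hT := registryCoupling_six_taylor (Δ := Δ) hs (by linarith [abs_nonneg Δ])
  have hb1 : 0 ≤ β₁ := (abs_nonneg _).trans h1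
  have hb2 : 0 ≤ β₂ := (abs_nonneg _).trans h2
  have e1 : |6 * Δ * registryCoupling 7 s₀| ≤ 6 * D * β₁ := by
    rw [abs_mul, abs_mul, abs_of_pos (by norm_num : (0:ℝ) < 6)]
    exact mul_le_mul (mul_le_mul_of_nonneg_left hΔ (by norm_num)) h1 (abs_nonneg _) (by positivity)
  have e2 : |21 * Δ ^ 2 * registryCoupling 8 s₀| ≤ 21 * D ^ 2 * β₂ := by
    rw [abs_mul, abs_mul, abs_of_pos (by norm_num : (0:ℝ) < 21), abs_pow]
    exact mul_le_mul (mul_le_mul_of_nonneg_left (pow_le_pow_left₀ (abs_nonneg Δ) hΔ 2) (by norm_num)) h2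
      (abs_nonneg _) (by positivity)
  have e3 : 200 * |Δ| ^ 3 * (layerSum 0 9 s₀ + layerSum 1 9 s₀) ≤ 200 * D ^ 3 * (2 * (s₀⁻¹) ^ 9 + 13 / 3 * (s₀⁻¹) ^ 8) :=
    mul_le_mul (mul_le_mul_of_nonneg_left (pow_le_pow_left₀ (abs_nonneg Δ) hΔ 3) (by norm_num)) (pair_nine_le hs)
      (add_nonneg (layerSum_nonneg (by norm_num) 9 hs.le) (layerSum_nonneg le_rfl 9 hs.le)) (by positivity)
  rw [abs_le] at hT e1 e2
  linarith [hT.1, hT.2, e1.1, e1.2, e2.1, e2.2]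

/-! ## §3 The driving layer `k = 2` over the window -/

/-- **`0.0004712 ≤ J⁽³⁾(4t)`** on the axial window `|t − 2/3| ≤ 1/340` (`Δ = 4t − 8/3`, `|Δ| ≤ 1/85`). [this file · kind: proof] -/
theorem three_window_two {t : ℝ} (ht : |t - 2 / 3| ≤ 1 / 340) : 0.0004712 ≤ registryCoupling 3 (4 * t) := by
  have hΔ : |4 * t - 8 / 3| ≤ 1 / 85 := by
    rw [show (4:ℝ) * t - 8 / 3 = 4 * (t - 2 / 3) by ring, abs_mul, abs_of_pos (by norm_num : (0:ℝ) < 4)]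
    linarith
  have h := registryCoupling_three_window_ge (s₀ := 8 / 3) (by norm_num) (by norm_num) hΔ registryCoupling_three_at_2.1
    (abs_le_of_mem (β := 0.000442569) registryCoupling_four_mem (by norm_num) (by norm_num))
    (le_trans (by norm_num) registryCoupling_5_mem_2.1)
  rw [show (8 / 3 : ℝ) + (4 * t - 8 / 3) = 4 * t by ring] at h
  exact le_trans (by norm_num) h

/-- **`J⁽⁶⁾(4t) ≤ 0.0002161`** on the axial window. [this file · kind: proof] -/
theorem six_window_two {t : ℝ} (ht : |t - 2 / 3| ≤ 1 / 340) : registryCoupling 6 (4 * t) ≤ 0.0002161 := by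
  have hΔ : |4 * t - 8 / 3| ≤ 1 / 85 := by
    rw [show (4:ℝ) * t - 8 / 3 = 4 * (t - 2 / 3) by ring, abs_mul, abs_of_pos (by norm_num : (0:ℝ) < 4)]
    linarith
  have h := registryCoupling_six_window_le (s₀ := 8 / 3) (by norm_num) (by norm_num) hΔ registryCoupling_six_at_2.2
    (abs_le_of_mem (β := 0.000118202) registryCoupling_seven_mem (by norm_num) (by norm_num))
    (abs_le_of_mem (β := 0.00006230) registryCoupling_8_mem_2 (by norm_num) (by norm_num))
  rw [show (8 / 3 : ℝ) + (4 * t - 8 / 3) = 4 * t by ring] at h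
  exact h.trans (by norm_num)

/-- ★ **The driving coupling over the axial window**: `J₂(a, a√t) ≤ (1/12)a⁻¹²·0.0002161 − (1/6)a⁻⁶·0.0004712` for `|t − 2/3| ≤ 1/340`
(ideal values `0.000206830`, `0.000488547`, `…TwinGainCertificate.twinJ_two_le`). [this file · kind: proof] -/
theorem windowJ_two_le (a : ℝ) {t : ℝ} (ht : |t - 2 / 3| ≤ 1 / 340) :
    barlowCoupling lennardJones a (a * Real.sqrt t) 2 ≤ 1 / 12 * (a⁻¹) ^ 12 * 0.0002161 - 1 / 6 * (a⁻¹) ^ 6 * 0.0004712 :=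
  barlowCoupling_lennardJones_sqrt_le a (window_nonneg ht) 2 (by norm_num) (three_window_two ht) (six_window_two ht)

/-! ## §4 The far layers over the window -/

/-- Far layers, `n = 3`: for `k ≥ 22` and `|t − 2/3| ≤ 1/340`, `|J⁽³⁾(k²t)| ≤ 126·k⁻⁶` (`k²t ≥ (677/1020)k² ≥ 321 ≥ 320`, the kit's
`registryCoupling_three_abs`; `(207/20)((1020/677)⁴/484 + (32/9)(1020/677)³) = 125.97 ≤ 126`). [this file · kind: proof] -/
theorem three_abs_far_window {k : ℕ} (hk : 22 ≤ k) {t : ℝ} (ht : |t - 2 / 3| ≤ 1 / 340) :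
    |registryCoupling 3 ((k : ℝ) ^ 2 * t)| ≤ 126 * ((k : ℝ)⁻¹) ^ 6 := by
  have hk' : (22 : ℝ) ≤ k := by exact_mod_cast hk
  have hkpos : (0 : ℝ) < k := by linarith
  have htlo : 677 / 1020 ≤ t := by linarith [neg_abs_le (t - 2 / 3)]
  set s : ℝ := (k : ℝ) ^ 2 * t with hs
  have hk2 : (484 : ℝ) ≤ (k : ℝ) ^ 2 := by nlinarith
  have hs320 : 320 ≤ s := by rw [hs]; nlinarith
  have hspos : 0 < s := by linarith
  refine (registryCoupling_three_abs hs320).trans ?_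
  -- `s⁻¹ ≤ (1020/677)·k⁻²`
  set v : ℝ := ((k : ℝ)⁻¹) ^ 2 with hv
  have hv0 : 0 < v := by positivity
  have hkv : (k : ℝ) ^ 2 * v = 1 := by rw [hv]; field_simp
  have hsi : s⁻¹ ≤ 1020 / 677 * v := by
    rw [inv_le_iff_one_le_mul₀ hspos, hs]
    nlinarith
  have hsi0 : 0 ≤ s⁻¹ := by positivity
  have hv22 : v ≤ 1 / 484 := by
    rw [hv, inv_pow]
    calc ((k : ℝ) ^ 2)⁻¹ ≤ ((22 : ℝ) ^ 2)⁻¹ := inv_anti₀ (by norm_num) (pow_le_pow_left₀ (by norm_num) hk' 2)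
      _ = 1 / 484 := by norm_num
  have h3 : (s⁻¹) ^ 3 ≤ (1020 / 677 * v) ^ 3 := pow_le_pow_left₀ hsi0 hsi 3
  have h4 : (s⁻¹) ^ 4 ≤ (1020 / 677 * v) ^ 4 := pow_le_pow_left₀ hsi0 hsi 4
  have e6 : ((k : ℝ)⁻¹) ^ 6 = v ^ 3 := by rw [hv]; ring
  rw [e6]
  have hv3 : 0 ≤ v ^ 3 := by positivity
  have hv4 : v ^ 4 ≤ 1 / 484 * v ^ 3 := by
    calc v ^ 4 = v * v ^ 3 := by ring
      _ ≤ 1 / 484 * v ^ 3 := mul_le_mul_of_nonneg_right hv22 hv3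
  nlinarith [h3, h4, hv4, hv3]

/-- Far layers, `n = 6`: for `k ≥ 22` and `|t − 2/3| ≤ 1/340`, `|J⁽⁶⁾(k²t)| ≤ k⁻⁶/5000` (crude bound `s⁻⁶ + 24/5·s⁻⁵`,
`(1020/677)⁶/484³ + (24/5)(1020/677)⁵/484² = 1.6·10⁻⁴ ≤ 1/5000`). [this file · kind: proof] -/
theorem six_abs_far_window {k : ℕ} (hk : 22 ≤ k) {t : ℝ} (ht : |t - 2 / 3| ≤ 1 / 340) :
    |registryCoupling 6 ((k : ℝ) ^ 2 * t)| ≤ 1 / 5000 * ((k : ℝ)⁻¹) ^ 6 := by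
  have hk' : (22 : ℝ) ≤ k := by exact_mod_cast hk
  have hkpos : (0 : ℝ) < k := by linarith
  have htlo : 677 / 1020 ≤ t := by linarith [neg_abs_le (t - 2 / 3)]
  set s : ℝ := (k : ℝ) ^ 2 * t with hs
  have hk2 : (484 : ℝ) ≤ (k : ℝ) ^ 2 := by nlinarith
  have hspos : 0 < s := by rw [hs]; nlinarith
  refine (registryCoupling_six_abs_crude hspos).trans ?_
  set v : ℝ := ((k : ℝ)⁻¹) ^ 2 with hv
  have hv0 : 0 < v := by positivity
  have hkv : (k : ℝ) ^ 2 * v = 1 := by rw [hv]; field_simp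
  have hsi : s⁻¹ ≤ 1020 / 677 * v := by
    rw [inv_le_iff_one_le_mul₀ hspos, hs]
    nlinarith
  have hsi0 : 0 ≤ s⁻¹ := by positivity
  have hv22 : v ≤ 1 / 484 := by
    rw [hv, inv_pow]
    calc ((k : ℝ) ^ 2)⁻¹ ≤ ((22 : ℝ) ^ 2)⁻¹ := inv_anti₀ (by norm_num) (pow_le_pow_left₀ (by norm_num) hk' 2)
      _ = 1 / 484 := by norm_num
  have h5 : (s⁻¹) ^ 5 ≤ (1020 / 677 * v) ^ 5 := pow_le_pow_left₀ hsi0 hsi 5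
  have h6 : (s⁻¹) ^ 6 ≤ (1020 / 677 * v) ^ 6 := pow_le_pow_left₀ hsi0 hsi 6
  have e6 : ((k : ℝ)⁻¹) ^ 6 = v ^ 3 := by rw [hv]; ring
  rw [e6]
  have hv3 : 0 ≤ v ^ 3 := by positivity
  have hv2 : v ^ 2 ≤ (1 / 484) ^ 2 := pow_le_pow_left₀ hv0.le hv22 2
  have hv5 : v ^ 5 ≤ (1 / 484) ^ 2 * v ^ 3 := by
    calc v ^ 5 = v ^ 2 * v ^ 3 := by ring
      _ ≤ (1 / 484) ^ 2 * v ^ 3 := mul_le_mul_of_nonneg_right hv2 hv3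
  have hv33 : v ^ 3 ≤ (1 / 484) ^ 3 := pow_le_pow_left₀ hv0.le hv22 3
  have hv6 : v ^ 6 ≤ (1 / 484) ^ 3 * v ^ 3 := by
    calc v ^ 6 = v ^ 3 * v ^ 3 := by ring
      _ ≤ (1 / 484) ^ 3 * v ^ 3 := mul_le_mul_of_nonneg_right hv33 hv3
  nlinarith [h5, h6, hv5, hv6, hv3]

/-- Far layer term over the window: `|J_{m+22}(a, a√t)| ≤ ((1/12)a⁻¹²/5000 + (1/6)a⁻⁶·126)·(m+22)⁻⁶`. [this file · kind: proof] -/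
theorem far_term_window_le (a : ℝ) {t : ℝ} (ht : |t - 2 / 3| ≤ 1 / 340) (m : ℕ) :
    |barlowCoupling lennardJones a (a * Real.sqrt t) (m + 21 + 1)| ≤
      (1 / 12 * (a⁻¹) ^ 12 * (1 / 5000) + 1 / 6 * (a⁻¹) ^ 6 * 126) * (((m + 21 + 1 : ℕ) : ℝ)⁻¹) ^ 6 := by
  have hk : 22 ≤ m + 21 + 1 := by omega
  have h := abs_barlowCoupling_lennardJones_sqrt_le a (window_nonneg ht) (m + 21 + 1) rfl
    (three_abs_far_window hk ht) (six_abs_far_window hk ht)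
  refine h.trans (le_of_eq ?_)
  ring

end Summit.AtomisticToContinuum.Crystallization.Theorems.OverbindingBudgetAffineRunCutAxialWindow

end
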